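import Summits.CriticalPhenomena.SAWScalingLimit.Theorems.SAWLoopFugacityFlowSimpleSubseqLimitsLineGlue
import Summits.CriticalPhenomena.SAWScalingLimit.Theorems.SAWTotalPositivityTPToTraversalBoundChainPieces
import Literature.Probability.Percolation.ExplorationCrossings
import Literature.Probability.LatticeModels.MedialExplorationChains
import HarnessLib

/-!
# Line `marked-point-revisit` — stub `stub_polylineTransfer` of the crux `SimpleSubseqLimits`
(stmt-CriticalPhenomena-4982; route decl
`Summit.CriticalPhenomena.SAWScalingLimit.Theses.SAWLoopFugacityFlow.SimpleSubseqLimits`;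
registered skeleton
`Summits/CriticalPhenomena/SAWScalingLimit/Cruxes/SimpleSubseqLimits/Lines/marked_point_revisit.lean`)

The POLYLINE TRANSFER: the lattice-native (vertex-level) no-touch input `LatticeNoTouch D a b`
implies the polyline form `Glue.NoTouchAt D a b` of the line glue
(`Theorems/SAWLoopFugacityFlowSimpleSubseqLimitsLineGlue.lean`).

* `VertexNearRevisit`, `LatticeNoTouch` — VERBATIM the registered skeleton's vocabulary
  (sub-namespace `…MarkedPointRevisit.Lattice`; definitionally equal to the skeleton's copies).
* `vertexNearRevisit_of_nearRevisit` — the deterministic inclusion: every point of the mesh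
  polyline `latticeCurve γ` is within `2δ` of the mesh point of the vertex of its current segment
  (`TPToTraversalBound.Radial.dist_toCurve_getVert_le`), and every segment index between (resp.
  below) the indices of two times is attained at an intermediate (resp. earlier) time
  (`Literature.Probability.Percolation.exists_pieceIdx_eq`), so each strict inequality of
  `Glue.NearRevisit (latticeCurve γ)` passes to the vertex sequence with a loss of `2δ` (`4δ` for
  the return distance).
* `stub_polylineTransfer` — the registered stub: call `LatticeNoTouch` at
  `(z, r/2, (r+R)/2, R, θ)`, answer with `(ε/2, (R₁+R)/2, (R+R₂)/2)`; for `0 < δ ≤ δ₀` the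
  polyline event is contained in the vertex event, so `measure_mono` eventually along `𝓝[>] 0`
  and `Filter.limsup_le_limsup`.
-/

noncomputable section

open MeasureTheory Filter Topology Set Metric
open Literature.Probability.RandomPlanarGeometry Literature.Probability.LatticeModels
open scoped ENNReal NNReal BoundedContinuousFunction unitInterval

namespace Summit.CriticalPhenomena.SAWScalingLimit.Theorems.SimpleSubseqLimits.MarkedPointRevisit.Lattice

open Summit.CriticalPhenomena.SAWScalingLimit.Theorems.SimpleSubseqLimits.MarkedPointRevisit.Glue
  (NearRevisit latticeCurve NoTouchAt)
open Summit.CriticalPhenomena.SAWScalingLimit.Theorems.TPToTraversalBound.Radial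
  (dist_toCurve_getVert_le)
open Literature.Probability.Percolation (exists_pieceIdx_eq)

/-! ## Vocabulary (verbatim the registered skeleton) -/

/-- **Vertex-level thickened marked-revisit configuration** of a lattice SAW `γ` of `Ω_δ` at centre `z`,
inner radii `r < r'`, annulus radii `R₁ < R₂` and return distance `ε`: there are vertex indices
`i ≤ j ≤ k ≤ |γ|` such that the `i`-th mesh point is `R₁`-far from `z` (the MARKED vertex), the mesh
points `i, …, j` are `R₂`-close to `z`, the `j`-th is `r'`-close, no mesh point up to the `i`-th is
`r`-close (so the stretch `i … j` belongs to the first `r`-approach of `z`), and the `k`-th mesh point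
returns `ε`-close to the `i`-th.  Pure lattice data: `SimpleGraph.Walk.getVert` and `meshPoint` only.
[folklore] -/
def VertexNearRevisit {Ω : Set ℂ} {δ : ℝ} {u v : Site 2} (γ : SAW.DomainSAW Ω δ u v)
    (z : ℂ) (r r' R₁ R₂ ε : ℝ) : Prop :=
  ∃ i j k : ℕ, i ≤ j ∧ j ≤ k ∧ k ≤ γ.walk.length ∧
    R₁ < dist (meshPoint δ (γ.walk.getVert i)) z ∧
    (∀ n : ℕ, i ≤ n → n ≤ j → dist (meshPoint δ (γ.walk.getVert n)) z < R₂) ∧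
    dist (meshPoint δ (γ.walk.getVert j)) z < r' ∧
    (∀ n : ℕ, n ≤ i → r < dist (meshPoint δ (γ.walk.getVert n)) z) ∧
    dist (meshPoint δ (γ.walk.getVert k)) (meshPoint δ (γ.walk.getVert i)) < ε

/-- **Lattice no-touch at `(D; a_δ, b_δ)`** (the line's ONE lattice input in lattice-native form): for
the critical SAW law `P_δ = SAW.law D δ (a δ) (b δ)`, every centre `z`, radii `0 < r < r' < R` and `θ > 0`
there are a return distance `ε > 0` and annulus radii `r' < R₁ < R < R₂` with
`limsup_{δ → 0⁺} P_δ[VertexNearRevisit γ z r r' R₁ R₂ ε] ≤ θ` — during its first `r`-approach of `z`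
(no earlier vertex `r`-close, a vertex now `r'`-close) the walk marks the vertices of the approach lying
beyond radius `R₁` (and, with everything up to the `r'`-close vertex, inside radius `R₂`), and a LATER
vertex returns `ε`-close to a marked one only with small probability.  An unconditional probability of
an event of the law the crux quantifies over; an `x_c`-statement; implies the polyline form
`Glue.NoTouchAt` (`stub_polylineTransfer`) and, like it, is implied by the summit conjecture and
necessary given `EventualTight` (nested thickenings shrink to a double point `γ lam = γ t'`,
`lam < T < t'`). [folklore] -/
def LatticeNoTouch (D : DobrushinDomain) (a b : ℝ → Site 2) : Prop :=
  ∀ (z : ℂ) (r r' R : ℝ), 0 < r → r < r' → r' < R → ∀ θ : ℝ≥0∞, 0 < θ →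
    ∃ ε R₁ R₂ : ℝ, 0 < ε ∧ r' < R₁ ∧ R₁ < R ∧ R < R₂ ∧
      limsup (fun δ : ℝ => SAW.law D.carrier δ (a δ) (b δ)
          {γ | VertexNearRevisit γ z r r' R₁ R₂ ε}) (𝓝[>] (0 : ℝ)) ≤ θ

/-! ## Bookkeeping of the mesh polyline -/

/-- At time `0` the polyline is on its first segment: `pieceIdx l 0 = 0`. [folklore] -/
theorem pieceIdx_zero {V : Type*} : ∀ l : List V, pieceIdx l 0 = 0
  | [] => rfl
  | _ :: _ => by
    unfold pieceIdx
    rw [dif_pos (by norm_num)]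

/-- The tail of the support of a walk has as many elements as the walk has steps. [folklore] -/
theorem length_support_tail {V : Type*} {G : SimpleGraph V} {a b : V} (p : G.Walk a b) :
    p.support.tail.length = p.length := by
  simp [SimpleGraph.Walk.length_support]

/-- The lattice polyline, pointwise (definitional). [folklore] -/
theorem latticeCurve_apply {Ω : Set ℂ} {δ : ℝ} {u v : Site 2} (γ : SAW.DomainSAW Ω δ u v)
    (t : I) : latticeCurve γ t = γ.walk.toCurve (meshPoint δ) t := rfl

/-- **The polyline stays within `2δ` of the mesh point of its current vertex** (restated for
`latticeCurve`). [folklore] -/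
theorem dist_latticeCurve_getVert_le {Ω : Set ℂ} {δ : ℝ} {u v : Site 2} (hδ : 0 ≤ δ)
    (γ : SAW.DomainSAW Ω δ u v) (t : I) :
    dist (latticeCurve γ t) (meshPoint δ (γ.walk.getVert (pieceIdx γ.walk.support.tail t))) ≤
      2 * δ := by
  rw [latticeCurve_apply]
  exact dist_toCurve_getVert_le hδ γ t

/-! ## The deterministic inclusion: polyline configuration ⇒ vertex configuration -/

/-- **KEY INCLUSION.** For a lattice SAW `γ` of `Ω_δ` (`0 ≤ δ`), a thickened marked-revisit
configuration of its POLYLINE with inner radius `ρ`, annulus radii `P₁ < P₂` and return distance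
`η` is a VERTEX-level configuration with inner radii `r < r'`, annulus radii `R₁ < R₂` and return
distance `ε` as soon as `r + 2δ ≤ ρ`, `ρ + 2δ ≤ r'`, `R₁ + 2δ ≤ P₁`, `P₂ + 2δ ≤ R₂`, `η + 4δ ≤ ε`:
take for `i ≤ j ≤ k` the segment indices (`pieceIdx γ.walk.support.tail`) of the three times
`lam < T < t'`; every polyline point is within `2δ` of the mesh point of its segment's vertex
(`dist_toCurve_getVert_le`), and the indices in `[i, j]` (resp. `[0, i]`) are the indices of
times in `[lam, T]` (resp. `[0, lam]`) by `exists_pieceIdx_eq`. [folklore] -/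
theorem vertexNearRevisit_of_nearRevisit {Ω : Set ℂ} {δ : ℝ} {u v : Site 2}
    (γ : SAW.DomainSAW Ω δ u v) (hδ : 0 ≤ δ) {z : ℂ} {r r' R₁ R₂ ε ρ P₁ P₂ η : ℝ}
    (h1 : r + 2 * δ ≤ ρ) (h2 : ρ + 2 * δ ≤ r') (h3 : R₁ + 2 * δ ≤ P₁) (h4 : P₂ + 2 * δ ≤ R₂)
    (h5 : η + 4 * δ ≤ ε) (h : NearRevisit (latticeCurve γ) z ρ P₁ P₂ η) :
    VertexNearRevisit γ z r r' R₁ R₂ ε := by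
  obtain ⟨lam, T, t', hlamT, hTt', hfar, hclose, htip, hbefore, hret⟩ := h
  have hP : ∀ s : I, dist (latticeCurve γ s)
      (meshPoint δ (γ.walk.getVert (pieceIdx γ.walk.support.tail s))) ≤ 2 * δ :=
    fun s => dist_latticeCurve_getVert_le hδ γ s
  refine ⟨pieceIdx γ.walk.support.tail lam, pieceIdx γ.walk.support.tail T,
    pieceIdx γ.walk.support.tail t', pieceIdx_mono _ hlamT.le, pieceIdx_mono _ hTt'.le,
    (pieceIdx_le _ t').trans (length_support_tail γ.walk).le, ?_, ?_, ?_, ?_, ?_⟩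
  · -- (a) the marked vertex is `R₁`-far
    have hd := dist_triangle (latticeCurve γ lam)
      (meshPoint δ (γ.walk.getVert (pieceIdx γ.walk.support.tail lam))) z
    linarith [hP lam]
  · -- (b) the vertices `i, …, j` are `R₂`-close
    intro n hin hnj
    obtain ⟨w, hw1, hw2, hw⟩ := exists_pieceIdx_eq γ.walk.support.tail hlamT.le n hin hnj
    have hd := dist_triangle (meshPoint δ (γ.walk.getVert n)) (latticeCurve γ w) z
    have hPw := hP w
    rw [hw, dist_comm] at hPw
    linarith [hclose w hw1 hw2]
  · -- (c) the `j`-th vertex is `r'`-close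
    have hd := dist_triangle (meshPoint δ (γ.walk.getVert (pieceIdx γ.walk.support.tail T)))
      (latticeCurve γ T) z
    have hPT := hP T
    rw [dist_comm] at hPT
    linarith
  · -- (d) no vertex up to the `i`-th is `r`-close
    intro n hn
    obtain ⟨w, -, hw2, hw⟩ := exists_pieceIdx_eq γ.walk.support.tail
      (show (0 : I) ≤ lam from lam.2.1) n (by rw [pieceIdx_zero]; exact Nat.zero_le n) hn
    have hd := dist_triangle (latticeCurve γ w) (meshPoint δ (γ.walk.getVert n)) z
    have hPw := hP w
    rw [hw] at hPw
    linarith [hbefore w hw2]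
  · -- (e) the `k`-th vertex returns `ε`-close to the `i`-th
    have hd := dist_triangle4 (meshPoint δ (γ.walk.getVert (pieceIdx γ.walk.support.tail t')))
      (latticeCurve γ t') (latticeCurve γ lam)
      (meshPoint δ (γ.walk.getVert (pieceIdx γ.walk.support.tail lam)))
    have h1' := hP t'
    rw [dist_comm] at h1'
    linarith [hP lam]

/-! ## The registered stub -/

/-- **POLYLINE TRANSFER (registered stub `stub_polylineTransfer` of crux
stmt-CriticalPhenomena-4982, line `marked-point-revisit`)**: the vertex form `LatticeNoTouch D a b`
implies the polyline form `Glue.NoTouchAt D a b`.  Given `NoTouchAt`'s data `(z, r, R, θ)`, call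
`LatticeNoTouch` at `(z, r/2, (r+R)/2, R, θ)`, obtaining `ε, R₁, R₂`; answer with `ε/2`,
`R₁' := (R₁+R)/2`, `R₂' := (R+R₂)/2`.  For
`0 < δ ≤ δ₀ := min (ε/8) (min (r/4) (min ((R-R₁)/4) (min ((R₂-R)/4) ((R-r)/4))))` the polyline
event `NearRevisit (latticeCurve γ) z r R₁' R₂' (ε/2)` is contained in
`VertexNearRevisit γ z (r/2) ((r+R)/2) R₁ R₂ ε` (`vertexNearRevisit_of_nearRevisit`), so the laws
compare eventually along `𝓝[>] 0` (`measure_mono`, `Ioc_mem_nhdsGT`) and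
`Filter.limsup_le_limsup` concludes. [folklore] -/
theorem stub_polylineTransfer :
    ∀ (D : DobrushinDomain) (a b : ℝ → Site 2), LatticeNoTouch D a b → NoTouchAt D a b := by
  intro D a b hL z r R hr hrR θ hθ
  obtain ⟨ε, R₁, R₂, hε, hR₁, hR₁R, hRR₂, hlim⟩ :=
    hL z (r / 2) ((r + R) / 2) R (by linarith) (by linarith) (by linarith) θ hθ
  refine ⟨ε / 2, (R₁ + R) / 2, (R + R₂) / 2, by linarith, by linarith, by linarith, by linarith,
    le_trans (limsup_le_limsup ?_) hlim⟩
  have hδ₀ : (0 : ℝ) <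
      min (ε / 8) (min (r / 4) (min ((R - R₁) / 4) (min ((R₂ - R) / 4) ((R - r) / 4)))) :=
    lt_min (by linarith) (lt_min (by linarith) (lt_min (by linarith) (lt_min (by linarith)
      (by linarith))))
  filter_upwards [Ioc_mem_nhdsGT hδ₀] with δ hδ
  obtain ⟨hδpos, hδle⟩ := hδ
  simp only [le_min_iff] at hδle
  obtain ⟨hδ1, hδ2, hδ3, hδ4, hδ5⟩ := hδle
  exact measure_mono fun γ hγ =>
    vertexNearRevisit_of_nearRevisit γ hδpos.le (by linarith) (by linarith) (by linarith)
      (by linarith) (by linarith) hγ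

end Summit.CriticalPhenomena.SAWScalingLimit.Theorems.SimpleSubseqLimits.MarkedPointRevisit.Lattice

end
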